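import Summits.CriticalPhenomena.PercolationContinuityZ3.Theorems.PercNearOneGluingNoHeavyLowerTailSahiHubTwoLevel
import Mathlib.Tactic.Linarith
import Mathlib.Tactic.LinearCombination
import HarnessLib

/-!
# `NoHeavyLowerTail` (crux stmt-CriticalPhenomena-4575), P2 — T₁(|C|=1): the KERNEL FORM of the hub two-level form and the
# h-FREE ("type-flow") CERTIFICATE FRAME

Memo `FROM-prim-masterthm-p2-g28-H-FREE-FLOW.md` §2 (seat `prim-masterthm-p2`, gen 28; `--supports stmt-CriticalPhenomena-4575`).
No `sorry`, no named facts, standard axioms.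

SETTING as in `…SahiHubTwoLevel`: hub coin `Z = Fin 2` (weight `wZ`), FKG blocks `α, β` (weights `wA, wB`), nested sections
`f : Fin 2 → Fin 2 → α → ℝ` (`f i z a`, c-level `i`, hub level `z`), `g : Fin 2 → Fin 2 → β → ℝ`, `h : Fin 2 → α → β → ℝ`; `TL = twoLevel` is the hub
two-level form whose nonnegativity gives Kahn's `C₃` on T₁(|C|=1) (`sahiE_three_nonneg_T1C1_of_twoLevel_nonneg`).

* `kernel` / `twoLevel_eq_kernel` — **THE KERNEL FORM** `TL = Σ_z wZ(z) Σ_b wB(b) Σ_a wA(a) h(z,a,b)·K(z,a,b)` with the explicit level kernel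
  `K(z,a,b) = 2f₀(z,a)g₀(z,b) + 2f₁(z,a)g₁(z,b) − f̄₀g₁(z,b) − f̄₁g₀(z,b) − ḡ₀f₁(z,a) − ḡ₁f₀(z,a) − κ`, `κ = E[f₀g₀] + E[f₁g₁] − f̄₀ḡ₁ − f̄₁ḡ₀` (GLOBAL
  means; `TL(h ≡ 1) = κ`).  Pure bookkeeping.
* `twoLevel_nonneg_of_typeFlow` — **THE h-FREE CERTIFICATE FRAME.**  Suppose nonnegative multipliers `lam z i z' b` (A-side), `mu z j z' a` (B-side)
  and a nonnegative vertical transfer `nu a b` satisfy, POINTWISE in `(a,b)`,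
  `certA 0 + certB 0 ≤ wZ 0·K(0,·,·) + nu` and `certA 1 + certB 1 + nu ≤ wZ 1·K(1,·,·)`, where
  `certA z a b = Σ_{i,z'} lam z i z' b · (f i z' a − F_i(z'))`, `certB z a b = Σ_{j,z'} mu z j z' a · (g j z' b − ḡ_j(z'))`.
  Then `TL ≥ 0` for h nonnegative and monotone in each argument.  Only Harris/FKG on `α` (for the fibres `a ↦ h(z,a,b)` against the sections
  `f i z'`), Harris/FKG on `β`, and `h(0,a,b) ≤ h(1,a,b)` are used — no ratio, no slice bound, no orientation; the certificate does not mention `h`.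
  Memo §2: for indicator data the frame is a finite LP in the type decomposition of `α` and `β` (depends only on `t` and the eight level means), feasible
  in 54 800/54 800 sampled cells (kit j223307) — the open finite-dimensional statement now carrying T₁(|C|=1) in an A/B-symmetric form.
* Combine with `sahiE_three_nonneg_T1C1_of_twoLevel_nonneg` (`…SahiHubTwoLevelE3`) to get Kahn's `C₃` on the T₁(|C|=1) triple at every c-bias.
HONEST LABEL: an identity and a certificate frame; `C₃`, T₁, T₁(|C|=1) OPEN. [this work]
-/

noncomputable section

open scoped Classical

namespace Summit.CriticalPhenomena.PercolationContinuityZ3.Theorems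

namespace SahiHubTwoLevel

open Finset Literature.Combinatorics.Sahi2008
open SahiTriangleSupermodular (fkg_sum)

section KernelDefs

variable {α β : Type} [Fintype α] [Fintype β]
  (wA : α → ℝ) (wB : β → ℝ) (wZ : Fin 2 → ℝ) (f : Fin 2 → Fin 2 → α → ℝ) (g : Fin 2 → Fin 2 → β → ℝ) (h : Fin 2 → α → β → ℝ)

/-- `κ = E[f₀g₀] + E[f₁g₁] − f̄₀ḡ₁ − f̄₁ḡ₀` (= `TL` at `h ≡ 1`; all moments through the hub level). [this work] -/
def kappa : ℝ :=
  (∑ z, wZ z * (Fm wA f 0 z * gm wB g 0 z)) + (∑ z, wZ z * (Fm wA f 1 z * gm wB g 1 z))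
    - fbar wA wZ f 0 * gbar wB wZ g 1 - fbar wA wZ f 1 * gbar wB wZ g 0

/-- **The level kernel** `K(z,a,b) = 2f₀g₀ + 2f₁g₁ − f̄₀g₁ − f̄₁g₀ − ḡ₀f₁ − ḡ₁f₀ − κ` (sections at hub level `z`, GLOBAL means). [this work] -/
def kernel (z : Fin 2) (a : α) (b : β) : ℝ :=
  2 * (f 0 z a * g 0 z b) + 2 * (f 1 z a * g 1 z b) - fbar wA wZ f 0 * g 1 z b - fbar wA wZ f 1 * g 0 z b
    - gbar wB wZ g 0 * f 1 z a - gbar wB wZ g 1 * f 0 z a - kappa wA wB wZ f g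

variable (lam : Fin 2 → Fin 2 → Fin 2 → β → ℝ) (mu : Fin 2 → Fin 2 → Fin 2 → α → ℝ)

/-- A-side certificate at level `z`: `certA z a b = Σ_{i,z'} lam z i z' b · (f i z' a − F_i(z'))` (a fibre-Harris functional on `α` with a
nonnegative multiplier depending on `b`). [this work] -/
def certA (z : Fin 2) (a : α) (b : β) : ℝ := ∑ i, ∑ z', lam z i z' b * (f i z' a - Fm wA f i z')

/-- B-side certificate at level `z`: `certB z a b = Σ_{j,z'} mu z j z' a · (g j z' b − ḡ_j(z'))`. [this work] -/
def certB (z : Fin 2) (a : α) (b : β) : ℝ := ∑ j, ∑ z', mu z j z' a * (g j z' b - gm wB g j z')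

end KernelDefs

section Kernel

variable {α β : Type} [Fintype α] [Fintype β]
  {wA : α → ℝ} {wB : β → ℝ} {wZ : Fin 2 → ℝ} {f : Fin 2 → Fin 2 → α → ℝ} {g : Fin 2 → Fin 2 → β → ℝ} {h : Fin 2 → α → β → ℝ}

/-- Inner (fibre) sum of `h·K` at `(z,b)` in the slices `Y_i(z,b)`, `H(z,b)`. [this work] -/
theorem sum_a_kernel (z : Fin 2) (b : β) :
    (∑ a, wA a * (h z a b * kernel wA wB wZ f g z a b)) =
      2 * (g 0 z b * Ysl wA f h 0 z b) + 2 * (g 1 z b * Ysl wA f h 1 z b)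
        - fbar wA wZ f 0 * (g 1 z b * Hsl wA h z b) - fbar wA wZ f 1 * (g 0 z b * Hsl wA h z b)
        - gbar wB wZ g 0 * Ysl wA f h 1 z b - gbar wB wZ g 1 * Ysl wA f h 0 z b
        - kappa wA wB wZ f g * Hsl wA h z b := by
  have e : ∀ a, wA a * (h z a b * kernel wA wB wZ f g z a b) =
      2 * (g 0 z b * (wA a * (f 0 z a * h z a b))) + 2 * (g 1 z b * (wA a * (f 1 z a * h z a b)))
        - fbar wA wZ f 0 * (g 1 z b * (wA a * h z a b)) - fbar wA wZ f 1 * (g 0 z b * (wA a * h z a b))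
        - gbar wB wZ g 0 * (wA a * (f 1 z a * h z a b)) - gbar wB wZ g 1 * (wA a * (f 0 z a * h z a b))
        - kappa wA wB wZ f g * (wA a * h z a b) := fun a => by unfold kernel; ring
  simp only [e, sum_sub_distrib, sum_add_distrib, ← mul_sum]
  rfl

/-- Outer (β) sum of the fibre sums at level `z` in the level moments `S^{gY}`, `S^{gH}`, `Ȳ`, `H̄`. [this work] -/
theorem sum_b_kernel (z : Fin 2) :
    (∑ b, wB b * ∑ a, wA a * (h z a b * kernel wA wB wZ f g z a b)) =
      2 * Sgy wA wB f g h 0 0 z + 2 * Sgy wA wB f g h 1 1 z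
        - fbar wA wZ f 0 * Sgh wA wB g h 1 z - fbar wA wZ f 1 * Sgh wA wB g h 0 z
        - gbar wB wZ g 0 * Ybar wA wB f h 1 z - gbar wB wZ g 1 * Ybar wA wB f h 0 z
        - kappa wA wB wZ f g * Hb wA wB h z := by
  have e : ∀ b, wB b * ∑ a, wA a * (h z a b * kernel wA wB wZ f g z a b) =
      2 * (wB b * (g 0 z b * Ysl wA f h 0 z b)) + 2 * (wB b * (g 1 z b * Ysl wA f h 1 z b))
        - fbar wA wZ f 0 * (wB b * (g 1 z b * Hsl wA h z b)) - fbar wA wZ f 1 * (wB b * (g 0 z b * Hsl wA h z b))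
        - gbar wB wZ g 0 * (wB b * Ysl wA f h 1 z b) - gbar wB wZ g 1 * (wB b * Ysl wA f h 0 z b)
        - kappa wA wB wZ f g * (wB b * Hsl wA h z b) := fun b => by rw [sum_a_kernel]; ring
  simp only [e, sum_sub_distrib, sum_add_distrib, ← mul_sum]
  rfl

/-- **THE KERNEL FORM OF THE HUB TWO-LEVEL FORM**: `TL = Σ_z wZ(z) Σ_b wB(b) Σ_a wA(a) h(z,a,b)·K(z,a,b)` (no hypothesis on the weights). [this work] -/
theorem twoLevel_eq_kernel :
    twoLevel wA wB wZ f g h = ∑ z, wZ z * ∑ b, wB b * ∑ a, wA a * (h z a b * kernel wA wB wZ f g z a b) := by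
  simp only [sum_b_kernel]
  unfold twoLevel hbar kappa
  simp only [Fin.sum_univ_two]
  ring

end Kernel

section Frame

variable {α β : Type} [Fintype α] [Fintype β]
  {wA : α → ℝ} {wB : β → ℝ} {wZ : Fin 2 → ℝ} {f : Fin 2 → Fin 2 → α → ℝ} {g : Fin 2 → Fin 2 → β → ℝ} {h : Fin 2 → α → β → ℝ}
  {lam : Fin 2 → Fin 2 → Fin 2 → β → ℝ} {mu : Fin 2 → Fin 2 → Fin 2 → α → ℝ} {nu : α → β → ℝ}

/-- One A-side Harris term is nonnegative: `Σ_b wB·φ(b)·Σ_a wA h(z,a,b)(f i z' a − F_i(z')) ≥ 0` for `φ ≥ 0` (FKG on `α` fibrewise). [this work] -/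
theorem harrisA_nonneg [DistribLattice α] (hA : IsFKGMeasure wA) (hB0 : ∀ b, 0 ≤ wB b)
    (hf0 : ∀ i z a, 0 ≤ f i z a) (hfa : ∀ i z, Monotone (f i z))
    (hh0 : ∀ z a b, 0 ≤ h z a b) (hha : ∀ z b, Monotone (fun a => h z a b))
    {φ : β → ℝ} (hφ : ∀ b, 0 ≤ φ b) (z i z' : Fin 2) :
    0 ≤ ∑ b, wB b * (φ b * ∑ a, wA a * (h z a b * (f i z' a - Fm wA f i z'))) := by
  refine sum_nonneg fun b _ => mul_nonneg (hB0 b) (mul_nonneg (hφ b) ?_)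
  have e : (∑ a, wA a * (h z a b * (f i z' a - Fm wA f i z'))) =
      (∑ a, wA a * (f i z' a * h z a b)) - (∑ a, wA a * f i z' a) * (∑ a, wA a * h z a b) := by
    have e1 : ∀ a, wA a * (h z a b * (f i z' a - Fm wA f i z')) =
        wA a * (f i z' a * h z a b) - Fm wA f i z' * (wA a * h z a b) := fun a => by ring
    simp only [e1, sum_sub_distrib, ← mul_sum]
    rfl
  rw [e]
  exact sub_nonneg.2 (fkg_sum hA (hf0 i z') (hh0 z · b) (hfa i z') (hha z b))

/-- One B-side Harris term is nonnegative: `Σ_a wA·ψ(a)·Σ_b wB h(z,a,b)(g j z' b − ḡ_j(z')) ≥ 0` for `ψ ≥ 0` (FKG on `β` fibrewise). [this work] -/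
theorem harrisB_nonneg [DistribLattice β] (hB : IsFKGMeasure wB) (hA0 : ∀ a, 0 ≤ wA a)
    (hg0 : ∀ j z b, 0 ≤ g j z b) (hgb : ∀ j z, Monotone (g j z))
    (hh0 : ∀ z a b, 0 ≤ h z a b) (hhb : ∀ z a, Monotone (h z a))
    {ψ : α → ℝ} (hψ : ∀ a, 0 ≤ ψ a) (z j z' : Fin 2) :
    0 ≤ ∑ a, wA a * (ψ a * ∑ b, wB b * (h z a b * (g j z' b - gm wB g j z'))) := by
  refine sum_nonneg fun a _ => mul_nonneg (hA0 a) (mul_nonneg (hψ a) ?_)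
  have e : (∑ b, wB b * (h z a b * (g j z' b - gm wB g j z'))) =
      (∑ b, wB b * (g j z' b * h z a b)) - (∑ b, wB b * g j z' b) * (∑ b, wB b * h z a b) := by
    have e1 : ∀ b, wB b * (h z a b * (g j z' b - gm wB g j z')) =
        wB b * (g j z' b * h z a b) - gm wB g j z' * (wB b * h z a b) := fun b => by ring
    simp only [e1, sum_sub_distrib, ← mul_sum]
    rfl
  rw [e]
  exact sub_nonneg.2 (fkg_sum hB (hg0 j z') (hh0 z a) (hgb j z') (hhb z a))

/-- Additivity of the double weighted sum. [folklore] -/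
theorem sum2_add (X Y : α → β → ℝ) :
    (∑ b, wB b * ∑ a, wA a * (X a b + Y a b)) = (∑ b, wB b * ∑ a, wA a * X a b) + ∑ b, wB b * ∑ a, wA a * Y a b := by
  rw [← sum_add_distrib]
  refine sum_congr rfl fun b _ => ?_
  rw [← mul_add, ← sum_add_distrib]
  exact congrArg _ (sum_congr rfl fun a _ => by ring)

/-- Homogeneity of the double weighted sum. [folklore] -/
theorem sum2_smul (c : ℝ) (X : α → β → ℝ) :
    (∑ b, wB b * ∑ a, wA a * (c * X a b)) = c * ∑ b, wB b * ∑ a, wA a * X a b := by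
  rw [mul_sum]
  refine sum_congr rfl fun b _ => ?_
  rw [mul_sum, mul_sum, mul_sum]
  exact sum_congr rfl fun a _ => by ring

/-- Exchange of the two weighted sums. [folklore] -/
theorem sum_swap (X : α → β → ℝ) :
    (∑ b, wB b * ∑ a, wA a * X a b) = ∑ a, wA a * ∑ b, wB b * X a b := by
  have e1 : (∑ b, wB b * ∑ a, wA a * X a b) = ∑ b, ∑ a, wB b * (wA a * X a b) :=
    sum_congr rfl fun b _ => mul_sum _ _ _
  have e2 : (∑ a, wA a * ∑ b, wB b * X a b) = ∑ a, ∑ b, wA a * (wB b * X a b) :=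
    sum_congr rfl fun a _ => mul_sum _ _ _
  rw [e1, e2, sum_comm]
  exact sum_congr rfl fun a _ => sum_congr rfl fun b _ => by ring

/-- The `h`-weighted A-certificate at level `z` is nonnegative. [this work] -/
theorem sum_certA_nonneg [DistribLattice α] (hA : IsFKGMeasure wA) (hB0 : ∀ b, 0 ≤ wB b)
    (hf0 : ∀ i z a, 0 ≤ f i z a) (hfa : ∀ i z, Monotone (f i z))
    (hh0 : ∀ z a b, 0 ≤ h z a b) (hha : ∀ z b, Monotone (fun a => h z a b))
    (hlam : ∀ z i z' b, 0 ≤ lam z i z' b) (z : Fin 2) :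
    0 ≤ ∑ b, wB b * ∑ a, wA a * (h z a b * certA wA f lam z a b) := by
  refine sum_nonneg fun b _ => mul_nonneg (hB0 b) ?_
  -- distribute the fibre sum over the four (i,z') terms
  have e : (∑ a, wA a * (h z a b * certA wA f lam z a b)) =
      ∑ i, ∑ z', lam z i z' b * ∑ a, wA a * (h z a b * (f i z' a - Fm wA f i z')) := by
    have e1 : ∀ a, wA a * (h z a b * certA wA f lam z a b) =
        ∑ i, ∑ z', lam z i z' b * (wA a * (h z a b * (f i z' a - Fm wA f i z'))) := fun a => by
      unfold certA
      rw [mul_sum, mul_sum]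
      refine sum_congr rfl fun i _ => ?_
      rw [mul_sum, mul_sum]
      exact sum_congr rfl fun z' _ => by ring
    rw [sum_congr rfl fun a _ => e1 a, sum_comm]
    refine sum_congr rfl fun i _ => ?_
    rw [sum_comm]
    exact sum_congr rfl fun z' _ => (mul_sum _ _ _).symm
  rw [e]
  refine sum_nonneg fun i _ => sum_nonneg fun z' _ => mul_nonneg (hlam z i z' b) ?_
  have key := harrisA_nonneg (wB := fun _ : β => (1 : ℝ)) hA (fun _ => zero_le_one) hf0 hfa hh0 hha
    (φ := fun b' : β => if b' = b then (1 : ℝ) else 0) (fun b' => by positivity) z i z'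
  simpa using key

/-- The `h`-weighted B-certificate at level `z` is nonnegative. [this work] -/
theorem sum_certB_nonneg [DistribLattice β] (hB : IsFKGMeasure wB) (hA0 : ∀ a, 0 ≤ wA a)
    (hg0 : ∀ j z b, 0 ≤ g j z b) (hgb : ∀ j z, Monotone (g j z))
    (hh0 : ∀ z a b, 0 ≤ h z a b) (hhb : ∀ z a, Monotone (h z a))
    (hmu : ∀ z j z' a, 0 ≤ mu z j z' a) (z : Fin 2) :
    0 ≤ ∑ b, wB b * ∑ a, wA a * (h z a b * certB wB g mu z a b) := by
  rw [sum_swap]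
  refine sum_nonneg fun a _ => mul_nonneg (hA0 a) ?_
  have e : (∑ b, wB b * (h z a b * certB wB g mu z a b)) =
      ∑ j, ∑ z', mu z j z' a * ∑ b, wB b * (h z a b * (g j z' b - gm wB g j z')) := by
    have e1 : ∀ b, wB b * (h z a b * certB wB g mu z a b) =
        ∑ j, ∑ z', mu z j z' a * (wB b * (h z a b * (g j z' b - gm wB g j z'))) := fun b => by
      unfold certB
      rw [mul_sum, mul_sum]
      refine sum_congr rfl fun j _ => ?_
      rw [mul_sum, mul_sum]
      exact sum_congr rfl fun z' _ => by ring
    rw [sum_congr rfl fun b _ => e1 b, sum_comm]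
    refine sum_congr rfl fun j _ => ?_
    rw [sum_comm]
    exact sum_congr rfl fun z' _ => (mul_sum _ _ _).symm
  rw [e]
  refine sum_nonneg fun j _ => sum_nonneg fun z' _ => mul_nonneg (hmu z j z' a) ?_
  have key := harrisB_nonneg (wA := fun _ : α => (1 : ℝ)) hB (fun _ => zero_le_one) hg0 hgb hh0 hhb
    (ψ := fun a' : α => if a' = a then (1 : ℝ) else 0) (fun a' => by positivity) z j z'
  simpa using key

/-- **THE h-FREE (TYPE-FLOW) CERTIFICATE FRAME FOR THE HUB TWO-LEVEL FORM** (memo §2(b)).  If nonnegative A-side multipliers `lam`, B-side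
multipliers `mu` and a vertical transfer `nu` satisfy, pointwise in `(a,b)`,
`certA 0 + certB 0 ≤ wZ 0·K(0,a,b) + nu(a,b)` and `certA 1 + certB 1 + nu(a,b) ≤ wZ 1·K(1,a,b)`, then `TL ≥ 0` for every nonnegative `h`
monotone in each argument.  Only fibrewise Harris on `α`, on `β`, and `h(0,·) ≤ h(1,·)` are used; the certificate does not mention `h`. [this work] -/
theorem twoLevel_nonneg_of_typeFlow [DistribLattice α] [DistribLattice β] (hA : IsFKGMeasure wA) (hB : IsFKGMeasure wB)
    (hf0 : ∀ i z a, 0 ≤ f i z a) (hfa : ∀ i z, Monotone (f i z))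
    (hg0 : ∀ j z b, 0 ≤ g j z b) (hgb : ∀ j z, Monotone (g j z))
    (hh0 : ∀ z a b, 0 ≤ h z a b) (hhz : ∀ a b, h 0 a b ≤ h 1 a b) (hha : ∀ z b, Monotone (fun a => h z a b))
    (hhb : ∀ z a, Monotone (h z a))
    (hlam : ∀ z i z' b, 0 ≤ lam z i z' b) (hmu : ∀ z j z' a, 0 ≤ mu z j z' a) (hnu : ∀ a b, 0 ≤ nu a b)
    (hcert0 : ∀ a b, certA wA f lam 0 a b + certB wB g mu 0 a b ≤ wZ 0 * kernel wA wB wZ f g 0 a b + nu a b)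
    (hcert1 : ∀ a b, certA wA f lam 1 a b + certB wB g mu 1 a b + nu a b ≤ wZ 1 * kernel wA wB wZ f g 1 a b) :
    0 ≤ twoLevel wA wB wZ f g h := by
  have hA0 := hA.nonneg; have hB0 := hB.nonneg
  rw [twoLevel_eq_kernel, Fin.sum_univ_two]
  -- pointwise lower bound by the certificates
  have hpt : ∀ a b, h 0 a b * (certA wA f lam 0 a b + certB wB g mu 0 a b - nu a b)
      + h 1 a b * (certA wA f lam 1 a b + certB wB g mu 1 a b + nu a b)
      ≤ h 0 a b * (wZ 0 * kernel wA wB wZ f g 0 a b) + h 1 a b * (wZ 1 * kernel wA wB wZ f g 1 a b) := fun a b =>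
    add_le_add (mul_le_mul_of_nonneg_left (by linarith [hcert0 a b]) (hh0 0 a b))
      (mul_le_mul_of_nonneg_left (hcert1 a b) (hh0 1 a b))
  -- the certificate side, summed, is nonnegative
  have hlow : 0 ≤ ∑ b, wB b * ∑ a, wA a * (h 0 a b * (certA wA f lam 0 a b + certB wB g mu 0 a b - nu a b)
      + h 1 a b * (certA wA f lam 1 a b + certB wB g mu 1 a b + nu a b)) := by
    have e : (∑ b, wB b * ∑ a, wA a * (h 0 a b * (certA wA f lam 0 a b + certB wB g mu 0 a b - nu a b)
        + h 1 a b * (certA wA f lam 1 a b + certB wB g mu 1 a b + nu a b))) =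
        (∑ b, wB b * ∑ a, wA a * (h 0 a b * certA wA f lam 0 a b))
        + (∑ b, wB b * ∑ a, wA a * (h 0 a b * certB wB g mu 0 a b))
        + (∑ b, wB b * ∑ a, wA a * (h 1 a b * certA wA f lam 1 a b))
        + (∑ b, wB b * ∑ a, wA a * (h 1 a b * certB wB g mu 1 a b))
        + (∑ b, wB b * ∑ a, wA a * (nu a b * (h 1 a b - h 0 a b))) := by
      have e1 : ∀ b, wB b * ∑ a, wA a * (h 0 a b * (certA wA f lam 0 a b + certB wB g mu 0 a b - nu a b)
          + h 1 a b * (certA wA f lam 1 a b + certB wB g mu 1 a b + nu a b)) =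
          wB b * (∑ a, wA a * (h 0 a b * certA wA f lam 0 a b)) + wB b * (∑ a, wA a * (h 0 a b * certB wB g mu 0 a b))
          + wB b * (∑ a, wA a * (h 1 a b * certA wA f lam 1 a b)) + wB b * (∑ a, wA a * (h 1 a b * certB wB g mu 1 a b))
          + wB b * (∑ a, wA a * (nu a b * (h 1 a b - h 0 a b))) := fun b => by
        have e2 : ∀ a, wA a * (h 0 a b * (certA wA f lam 0 a b + certB wB g mu 0 a b - nu a b)
            + h 1 a b * (certA wA f lam 1 a b + certB wB g mu 1 a b + nu a b)) =
            wA a * (h 0 a b * certA wA f lam 0 a b) + wA a * (h 0 a b * certB wB g mu 0 a b)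
            + wA a * (h 1 a b * certA wA f lam 1 a b) + wA a * (h 1 a b * certB wB g mu 1 a b)
            + wA a * (nu a b * (h 1 a b - h 0 a b)) := fun a => by ring
        rw [sum_congr rfl fun a _ => e2 a]
        simp only [sum_add_distrib, mul_sum, mul_add]
      rw [sum_congr rfl fun b _ => e1 b]
      simp only [sum_add_distrib]
    rw [e]
    have t1 := sum_certA_nonneg hA hB0 hf0 hfa hh0 hha hlam 0
    have t2 := sum_certB_nonneg hB hA0 hg0 hgb hh0 hhb hmu 0
    have t3 := sum_certA_nonneg hA hB0 hf0 hfa hh0 hha hlam 1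
    have t4 := sum_certB_nonneg hB hA0 hg0 hgb hh0 hhb hmu 1
    have t5 : 0 ≤ ∑ b, wB b * ∑ a, wA a * (nu a b * (h 1 a b - h 0 a b)) :=
      sum_nonneg fun b _ => mul_nonneg (hB0 b) (sum_nonneg fun a _ =>
        mul_nonneg (hA0 a) (mul_nonneg (hnu a b) (sub_nonneg.2 (hhz a b))))
    linarith
  -- compare term by term
  have hcmp : (∑ b, wB b * ∑ a, wA a * (h 0 a b * (certA wA f lam 0 a b + certB wB g mu 0 a b - nu a b)
      + h 1 a b * (certA wA f lam 1 a b + certB wB g mu 1 a b + nu a b)))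
      ≤ ∑ b, wB b * ∑ a, wA a * (h 0 a b * (wZ 0 * kernel wA wB wZ f g 0 a b) + h 1 a b * (wZ 1 * kernel wA wB wZ f g 1 a b)) :=
    sum_le_sum fun b _ => mul_le_mul_of_nonneg_left (sum_le_sum fun a _ => mul_le_mul_of_nonneg_left (hpt a b) (hA0 a)) (hB0 b)
  have e : wZ 0 * (∑ b, wB b * ∑ a, wA a * (h 0 a b * kernel wA wB wZ f g 0 a b))
      + wZ 1 * (∑ b, wB b * ∑ a, wA a * (h 1 a b * kernel wA wB wZ f g 1 a b)) =
      ∑ b, wB b * ∑ a, wA a * (h 0 a b * (wZ 0 * kernel wA wB wZ f g 0 a b) + h 1 a b * (wZ 1 * kernel wA wB wZ f g 1 a b)) := by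
    rw [sum2_add, ← sum2_smul (wZ 0), ← sum2_smul (wZ 1)]
    congr 1
    · exact sum_congr rfl fun b _ => congrArg _ (sum_congr rfl fun a _ => by ring)
    · exact sum_congr rfl fun b _ => congrArg _ (sum_congr rfl fun a _ => by ring)
  rw [e]
  linarith

end Frame

end SahiHubTwoLevel

end Summit.CriticalPhenomena.PercolationContinuityZ3.Theorems
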